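import Summits.RiemannHypothesis.RiemannHypothesis.Theorems.Splittings.LiExtremalLayerWindow
import HarnessLib

/-!
# Window mean of the trigonometric TURÁN expression `h(n+1)² − h(n)h(n+2)` (SketchG10 §4)

Cell rh-split, seat rh-split-li-bridge g10 (brief sha16 f79c5f09d8bcb036), card `run/shared/lean/pub/rh-split/cards/SPLIT-li-bridge.md` §17;
kernel source `HOME/rh-split-li-bridge/SketchG10.lean` sha16 38c6e923d0f0bc96 (759 l, farm rc 0 · 0 err · 0 warn, std axioms), cut by the seat
at the scratch's section boundaries (§§1–3 / §4 / §§5–6), decl text byte-verbatim; deltas = namespace `RhSplit.LiBridgeG10` ↦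
`…Theorems.Splittings.LiTuranLaw`, imports, module docstrings.
Tree inputs only: the window file `LiExtremalLayerWindow` (`trigSum E m u n = Σ_i m_i Re(u_iⁿ)`, `varConst`, `norm_sum_Ico_pow_le`,
`re_mul_re`).  Standard axioms.  Zero definitions.  GENERIC (no zeta input): for weights `m_i ≥ 0` and unit rotations `‖u_i‖ = 1`,

  `(L/2)·Σ_i m_i²(1 − Re(u_i²)) − 2·varConst ≤ Σ_{n ∈ [N, N+L)} (h(n+1)² − h(n)h(n+2))`        (`sum_turanTrig_ge`),

the Turán analogue of the window file's `sum_trigSum_sq_ge`.  Proof: expand over pairs `(i, j)`; each pair term is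
`m_im_j/2 · [Re((u_iu_j)ⁿ u_j(u_i − u_j)) + Re((u_iū_j)ⁿ ū_j(u_i − ū_j))]`; a non-resonant rotation sums to `O(1/‖1 − v‖)` over the
window, a resonant one (`v = 1`) contributes `L·Re w ≥ 0` (`Re(1 − u_j²) ≥ 0`), and the diagonal resonance `u_iū_i = 1` contributes
exactly `L·m_i²(1 − Re u_i²)/2`.  Used by `LiTuranLaw` (the `¬RH` branch of the Turán law for Li's coefficients).

HONEST LABEL: «SPLITTING SEARCH over kernel-typed RH-EQUIVALENCES; a splitting A ∧ B ⟹ RH is CONDITIONAL bookkeeping unless A and B are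
both proved; nothing here bears on the truth of RH.»  The theorem below is an unconditional inequality about finite trigonometric sums; it says nothing about `ζ`.
-/

set_option linter.dupNamespace false

noncomputable section

open Filter Topology
open scoped ComplexConjugate

namespace Summit.RiemannHypothesis.RiemannHypothesis.Theorems.Splittings.LiTuranLaw

open Summit.RiemannHypothesis.RiemannHypothesis.Theorems.Splittings
open Summit.RiemannHypothesis.RiemannHypothesis.Theorems.Splittings.LiExtremalLayer

/-! ## §4 Window mean of the trigonometric Turán expression (generic positive-weight sums on the unit circle)

Under `¬RH`, `r₀^{2n+2} T_{n+1} = D(n) + o(1)` with `D(n) = h(n+1)² − h(n)h(n+2)` for the layer's positive-weight trigonometric sum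
`h`.  Expanding `D` over pairs of rotations and summing over a window `[N, N+L)`, every non-resonant pair contributes `O(1)`, every
resonance contributes `≥ 0`, and the diagonal contributes `L·m_i²(1 − Re u_i²)/2 > 0` (`u_i ≠ ±1`): `Σ_{window} D ≥ (L/2)μ − 2C₂`
(`sum_turanTrig_ge`).  Hence `D ≥ 1/L` somewhere in every long window, and `T_{n+1} > 0` there. Combined with §2: RH-FREE. -/

section TrigWindow

variable {ι : Type*} {E : Finset ι} {m : ι → ℝ} {u : ι → ℂ}

/-- Window floor for `Re((Σ_{n∈[N,N+L)} vⁿ)·w)`: `≥ −4/‖1 − v‖` when `‖v‖ ≤ 1`, `‖w‖ ≤ 2`, and in the resonant case `v = 1`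
(where `4/‖1 − v‖ = 0`) provided `Re w ≥ 0`. -/
private theorem re_windowSum_mul_ge {v w : ℂ} (hv : ‖v‖ ≤ 1) (hw : ‖w‖ ≤ 2) (hres : v = 1 → 0 ≤ w.re) (N L : ℕ) :
    -(4 / ‖1 - v‖) ≤ ((∑ n ∈ Finset.Ico N (N + L), v ^ n) * w).re := by
  by_cases hv1 : v = 1
  · have hw0 := hres hv1
    subst hv1
    simp only [one_pow, Finset.sum_const, Nat.card_Ico, Nat.add_sub_cancel_left, nsmul_eq_mul, mul_one,
      sub_self, norm_zero, div_zero, neg_zero, Complex.mul_re, Complex.natCast_re, Complex.natCast_im,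
      zero_mul, sub_zero]
    positivity
  · have h1 := norm_sum_Ico_pow_le hv hv1 N L
    have h2 : ‖(∑ n ∈ Finset.Ico N (N + L), v ^ n) * w‖ ≤ 2 / ‖1 - v‖ * 2 := by
      rw [norm_mul]
      exact mul_le_mul h1 hw (norm_nonneg _) (by positivity)
    have h3 := (abs_le.1 ((Complex.abs_re_le_norm _).trans h2)).1
    have h4 : (4 : ℝ) / ‖1 - v‖ = 2 / ‖1 - v‖ * 2 := by ring
    linarith

/-- The pair term of `h(n+1)² − h(n)h(n+2)`:
`a Re(x^{n+1})·b Re(y^{n+1}) − a Re(xⁿ)·b Re(y^{n+2}) = ab·[Re((xy)ⁿ(xy − y²)) + Re((xȳ)ⁿ(xȳ − ȳ²))]/2`. -/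
private theorem turan_pair_term (a b : ℝ) (x y : ℂ) (n : ℕ) :
    a * (x ^ (n + 1)).re * (b * (y ^ (n + 1)).re) - a * (x ^ n).re * (b * (y ^ (n + 2)).re) =
      a * b * ((((x * y) ^ n * (x * y - y ^ 2)).re + ((x * conj y) ^ n * (x * conj y - conj y ^ 2)).re) / 2) := by
  have e1 : (x * y) ^ n * (x * y - y ^ 2) = x ^ (n + 1) * y ^ (n + 1) - x ^ n * y ^ (n + 2) := by ring
  have e2 : (x * conj y) ^ n * (x * conj y - conj y ^ 2) =
      x ^ (n + 1) * conj y ^ (n + 1) - x ^ n * conj y ^ (n + 2) := by ring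
  have h1 : (x ^ (n + 1)).re * (y ^ (n + 1)).re =
      ((x ^ (n + 1) * y ^ (n + 1)).re + (x ^ (n + 1) * conj y ^ (n + 1)).re) / 2 := by
    rw [re_mul_re, map_pow]
  have h2 : (x ^ n).re * (y ^ (n + 2)).re =
      ((x ^ n * y ^ (n + 2)).re + (x ^ n * conj y ^ (n + 2)).re) / 2 := by
    rw [re_mul_re, map_pow]
  have e : a * (x ^ (n + 1)).re * (b * (y ^ (n + 1)).re) - a * (x ^ n).re * (b * (y ^ (n + 2)).re) =
      a * b * ((x ^ (n + 1)).re * (y ^ (n + 1)).re) - a * b * ((x ^ n).re * (y ^ (n + 2)).re) := by ring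
  rw [e, h1, h2, e1, e2, Complex.sub_re, Complex.sub_re]
  ring

/-- **Window mean of the trigonometric Turán expression.**  For `m_i ≥ 0`, `‖u_i‖ = 1`:
`(L/2)·Σ_i m_i²(1 − Re(u_i²)) − 2C₂ ≤ Σ_{n∈[N,N+L)} (h(n+1)² − h(n)h(n+2))`, `C₂ = varConst` of the window file. -/
theorem sum_turanTrig_ge (hm : ∀ i ∈ E, 0 ≤ m i) (hu : ∀ i ∈ E, ‖u i‖ = 1) (N L : ℕ) :
    (L : ℝ) / 2 * (∑ i ∈ E, m i ^ 2 * (1 - (u i ^ 2).re)) - 2 * varConst E m u ≤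
      ∑ n ∈ Finset.Ico N (N + L), (trigSum E m u (n + 1) ^ 2 - trigSum E m u n * trigSum E m u (n + 2)) := by
  classical
  have hexp : ∀ n, trigSum E m u (n + 1) ^ 2 - trigSum E m u n * trigSum E m u (n + 2) =
      ∑ i ∈ E, ∑ j ∈ E, m i * m j *
        ((((u i * u j) ^ n * (u i * u j - u j ^ 2)).re +
          ((u i * conj (u j)) ^ n * (u i * conj (u j) - conj (u j) ^ 2)).re) / 2) := by
    intro n
    rw [trigSum, trigSum, trigSum, sq, Finset.sum_mul_sum, Finset.sum_mul_sum, ← Finset.sum_sub_distrib]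
    refine Finset.sum_congr rfl fun i _ ↦ ?_
    rw [← Finset.sum_sub_distrib]
    exact Finset.sum_congr rfl fun j _ ↦ turan_pair_term (m i) (m j) (u i) (u j) n
  simp_rw [hexp]
  rw [Finset.sum_comm]
  simp_rw [Finset.sum_comm (s := Finset.Ico N (N + L)) (t := E), ← Finset.mul_sum, ← Finset.sum_div,
    Finset.sum_add_distrib, ← Complex.re_sum, ← Finset.sum_mul]
  have hterm : ∀ i ∈ E, ∀ j ∈ E,
      -(2 * (m i * m j * (1 / ‖1 - u i * u j‖ + 1 / ‖1 - u i * conj (u j)‖))) +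
          (if i = j then m i ^ 2 * (1 - (u i ^ 2).re) * ((L : ℝ) / 2) else 0) ≤
        m i * m j * ((((∑ n ∈ Finset.Ico N (N + L), (u i * u j) ^ n) * (u i * u j - u j ^ 2)).re +
          ((∑ n ∈ Finset.Ico N (N + L), (u i * conj (u j)) ^ n) * (u i * conj (u j) - conj (u j) ^ 2)).re) / 2) := by
    intro i hi j hj
    have hij1 : ‖u i * u j‖ ≤ 1 := by rw [norm_mul, hu i hi, hu j hj, one_mul]
    have hij2 : ‖u i * conj (u j)‖ ≤ 1 := by rw [norm_mul, Complex.norm_conj, hu i hi, hu j hj, one_mul]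
    have hsq1 : ‖u j ^ 2‖ = 1 := by rw [norm_pow, hu j hj, one_pow]
    have hsq2 : ‖conj (u j) ^ 2‖ = 1 := by rw [norm_pow, Complex.norm_conj, hu j hj, one_pow]
    have hw1 : ‖u i * u j - u j ^ 2‖ ≤ 2 := (norm_sub_le _ _).trans (by rw [hsq1]; linarith)
    have hw2 : ‖u i * conj (u j) - conj (u j) ^ 2‖ ≤ 2 := (norm_sub_le _ _).trans (by rw [hsq2]; linarith)
    have hre1 : (u j ^ 2).re ≤ 1 := (Complex.re_le_norm _).trans hsq1.le
    have hre2 : (conj (u j) ^ 2).re ≤ 1 := (Complex.re_le_norm _).trans hsq2.le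
    have hres1 : u i * u j = 1 → 0 ≤ (u i * u j - u j ^ 2).re := fun h ↦ by
      rw [h, Complex.sub_re, Complex.one_re]; linarith
    have hres2 : u i * conj (u j) = 1 → 0 ≤ (u i * conj (u j) - conj (u j) ^ 2).re := fun h ↦ by
      rw [h, Complex.sub_re, Complex.one_re]; linarith
    have hA := re_windowSum_mul_ge hij1 hw1 hres1 N L
    have hB := re_windowSum_mul_ge hij2 hw2 hres2 N L
    have hmm : 0 ≤ m i * m j := mul_nonneg (hm i hi) (hm j hj)
    have hinv1 : 0 ≤ 1 / ‖1 - u i * u j‖ := by positivity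
    have hinv2 : 0 ≤ 1 / ‖1 - u i * conj (u j)‖ := by positivity
    by_cases hij : i = j
    · subst hij
      have hone : u i * conj (u i) = 1 := by
        rw [Complex.mul_conj, ← Complex.sq_norm, hu i hi]; norm_num
      have hzero : u i * u i - u i ^ 2 = 0 := by ring
      rw [if_pos rfl, hzero, mul_zero, Complex.zero_re, zero_add, hone]
      simp only [one_pow, Finset.sum_const, Nat.card_Ico, Nat.add_sub_cancel_left, nsmul_eq_mul, mul_one,
        sub_self, norm_zero, div_zero, add_zero]
      have hcre : ((L : ℂ) * (1 - conj (u i) ^ 2)).re = L * (1 - (u i ^ 2).re) := by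
        rw [Complex.mul_re, Complex.natCast_re, Complex.natCast_im, zero_mul, sub_zero, Complex.sub_re,
          Complex.one_re, ← map_pow, Complex.conj_re]
      rw [hcre]
      have e : m i ^ 2 = m i * m i := sq (m i)
      rw [e]
      have hnn := mul_nonneg hmm hinv1
      nlinarith [hm i hi, hnn]
    · rw [if_neg hij, add_zero]
      rw [div_eq_mul_one_div] at hA hB
      have h2 := mul_le_mul_of_nonneg_left (add_le_add hA hB) hmm
      linarith
  calc (L : ℝ) / 2 * (∑ i ∈ E, m i ^ 2 * (1 - (u i ^ 2).re)) - 2 * varConst E m u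
      = ∑ i ∈ E, ∑ j ∈ E, (-(2 * (m i * m j * (1 / ‖1 - u i * u j‖ + 1 / ‖1 - u i * conj (u j)‖))) +
          (if i = j then m i ^ 2 * (1 - (u i ^ 2).re) * ((L : ℝ) / 2) else 0)) := by
        simp only [Finset.sum_add_distrib, Finset.sum_neg_distrib, Finset.sum_ite_eq, varConst,
          ← Finset.mul_sum]
        have : ∑ i ∈ E, (if i ∈ E then m i ^ 2 * (1 - (u i ^ 2).re) * ((L : ℝ) / 2) else 0) =
            (∑ i ∈ E, m i ^ 2 * (1 - (u i ^ 2).re)) * ((L : ℝ) / 2) := by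
          rw [Finset.sum_mul]; exact Finset.sum_congr rfl fun i hi ↦ by rw [if_pos hi]
        rw [this]
        ring
    _ ≤ _ := Finset.sum_le_sum fun i hi ↦ Finset.sum_le_sum fun j hj ↦ hterm i hi j hj

end TrigWindow

end Summit.RiemannHypothesis.RiemannHypothesis.Theorems.Splittings.LiTuranLaw

end
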